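import Literature.AnabelianGeometry.SemiGraphs.ChartFibreFunctorFin
import HarnessLib

/-!
# [SemiAnbd] §3 Prop. 3.6 (iii): finite objects of `B^temp(π₁^temp(𝒢))` are the finite étale coverings

Mochizuki, *Semi-graphs of anabelioids*, Publ. RIMS **42** (2006), Prop. 3.6 (ii)–(iii) p. 38: the chart
`B^temp(π₁^temp(G)) ⥲ B^temp(G)` and "the full embedding `B(G) ↪ B^temp(G)`" — through the chart, the
finite étale coverings of `G` are exactly the FINITE continuous `π₁^temp(G)`-sets, which is why
"`π̂₁(G)` is the profinite completion of `π₁^temp(G)`" [cite: MochizukiSemiAnbd2006, Prop 3.6(iii) p.38].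
Sequel to `ChartFibreFunctor(Fin).lean` (abc-iut L3, B7b part 2a/2b):

* `BTemp.toContAction` — an object of `B^temp(Π)` with finite underlying set as an object of `B(Π)`
  (`toBTemp` of it is the object back, `BTemp.toBTempToContActionIso`);
* `CovObj.isFinite_of_finite_SV` — over a CONNECTED semi-graph a covering with one finite vertex fibre
  is finite (the gluings are bijections along the subdivision);
* `chartToBObj c : B(π₁^temp(𝒢)) ⥤ B(𝒢.toAnab)` — a finite continuous `π₁^temp(𝒢)`-set is carried
  by `c⁻¹` to a finite (by a verticial homomorphism + connectedness) tempered covering, i.e. to a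
  finite étale covering (`equivBFin`);
* `chartToBObjIso : chartToBObj ⋙ ofBObjTemp ⋙ c ≅ toBTemp` and its shadow on fibre functors
  `chartFibreToBObjIso : chartToBObj ⋙ chartFibre ≅ forget ⋙ incl`, EQUIVARIANT for the chart action
  versus the tautological action (`chartFibreToBObjIso_equivariant`);
* `chartToBObjObjIso` — every `X ∈ B(𝒢.toAnab)` is `chartToBObj` of the finite `π₁^temp`-set `c(X)`.

Nothing here takes a side on [IUTchIII] Cor. 3.12.
-/

noncomputable section

namespace Literature.AnabelianGeometry.SemiGraphs

open CategoryTheory CategoryTheory.Limits CategoryTheory.PreGaloisCategory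
open Literature.AnabelianGeometry.Anabelioids
open Literature.AlgebraicGeometry.Frobenioids (BCat)
open scoped FintypeCatDiscrete Pointwise

universe u

/-! ### Finite objects of `B^temp(Π)` as objects of `B(Π)` -/

section FinObj

variable (G : Type u) [Group G] [TopologicalSpace G] [IsTopologicalGroup G]

variable {G} in
/-- An object of `B^temp(Π)` with FINITE underlying set, as a finite continuous `Π`-set (continuity =
open stabilisers, [SemiAnbd] §3 p. 33; Def. 3.5 (i) p. 37 "finite objects of `B^cov`").
[cite: MochizukiSemiAnbd2006, Def 3.5(i) p.37] -/
def BTemp.toContAction (X : BTemp G) [Finite X.obj.V] : BCat G :=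
  ⟨{ V := FintypeCat.of X.obj.V
     ρ := { toFun := fun g => FintypeCat.homMk fun x => X.obj.ρ g x
            map_one' := by
              apply ConcreteCategory.hom_ext
              intro x
              simp only [map_one]
              rfl
            map_mul' := fun g g' => by
              apply ConcreteCategory.hom_ext
              intro x
              simp only [map_mul]
              rfl } },
    (isContinuous_iff_stabilizer_isOpen _).mpr fun x => X.property.2 x⟩

variable {G} in
/-- `toBTemp (toContAction X) ≅ X` by the identity of underlying sets. [cite: MochizukiSemiAnbd2006, Def 3.5(i) p.37] -/
def BTemp.toBTempToContActionIso (X : BTemp G) [Finite X.obj.V] :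
    (toBTemp G).obj (BTemp.toContAction X) ≅ X :=
  (temperedAction G).isoMk (Action.mkIso (Iso.refl _) (fun _ => rfl))

variable {G} in
/-- On elements `toBTempToContActionIso` is the identity. [cite: MochizukiSemiAnbd2006, Def 3.5(i) p.37] -/
@[simp] theorem BTemp.toBTempToContActionIso_hom_apply (X : BTemp G) [Finite X.obj.V]
    (x : ((toBTemp G).obj (BTemp.toContAction X)).obj.V) :
    (BTemp.toBTempToContActionIso X).hom.hom.hom x = x := rfl

end FinObj

namespace ProfiniteSemiGraph

variable {𝒢 : ProfiniteSemiGraph.{u}}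

/-! ### Finiteness of coverings over a connected semi-graph -/

/-- The fibre of a covering over a node of the barycentric subdivision (a branch node carries the fibre
of its edge). [cite: MochizukiSemiAnbd2006, §3 p.36] -/
def CovObj.nodeFibre (S : CovObj 𝒢) : 𝒢.graph.Node → Type u
  | Sum.inl v => (S.SV v).obj.V
  | Sum.inr (Sum.inl e) => (S.SE e).obj.V
  | Sum.inr (Sum.inr b) => (S.SE (𝒢.graph.edgeOf b)).obj.V

/-- Adjacent nodes of the subdivision carry fibres in bijection (the gluings); hence finiteness of fibres
propagates along the subdivision. [cite: MochizukiSemiAnbd2006, §3 p.36] -/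
theorem CovObj.finite_nodeFibre_of_nodeRel (S : CovObj 𝒢) :
    ∀ {m n : 𝒢.graph.Node}, 𝒢.graph.NodeRel m n → (Finite (S.nodeFibre m) ↔ Finite (S.nodeFibre n))
  | _, _, SemiGraph.NodeRel.edge_branch b => Iff.rfl
  | _, _, SemiGraph.NodeRel.branch_vertex b v hb => by
    change Finite (S.SE (𝒢.graph.edgeOf b)).obj.V ↔ Finite (S.SV v).obj.V
    have e : (S.SE (𝒢.graph.edgeOf b)).obj.V ≃ (S.SV v).obj.V :=
      { toFun := fun x => (S.glue b v hb).hom.hom.hom x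
        invFun := fun y => (S.glue b v hb).inv.hom.hom y
        left_inv := fun x => by
          change ((S.glue b v hb).hom ≫ (S.glue b v hb).inv).hom.hom x = x
          rw [Iso.hom_inv_id]
          rfl
        right_inv := fun y => by
          change ((S.glue b v hb).inv ≫ (S.glue b v hb).hom).hom.hom y = y
          rw [Iso.inv_hom_id]
          rfl }
    exact ⟨fun _ => Finite.of_equiv _ e, fun _ => Finite.of_equiv _ e.symm⟩

/-- Finiteness of fibres is constant on connected components of the subdivision.
[cite: MochizukiSemiAnbd2006, §3 p.36] -/
theorem CovObj.finite_nodeFibre_of_reachable (S : CovObj 𝒢) {m n : 𝒢.graph.Node}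
    (h : 𝒢.graph.subdivision.Reachable m n) :
    Finite (S.nodeFibre m) ↔ Finite (S.nodeFibre n) := by
  rw [SimpleGraph.reachable_iff_reflTransGen] at h
  induction h with
  | refl => exact Iff.rfl
  | tail _ hbc ih =>
    rw [ih]
    obtain ⟨_, h | h⟩ := (SimpleGraph.fromRel_adj _ _ _).mp hbc
    · exact S.finite_nodeFibre_of_nodeRel h
    · exact (S.finite_nodeFibre_of_nodeRel h).symm

/-- **Over a connected semi-graph, a covering with ONE finite vertex fibre is finite.**
[cite: MochizukiSemiAnbd2006, §3 p.36] -/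
theorem CovObj.isFinite_of_finite_SV (hconn : 𝒢.graph.IsConnected) (S : CovObj 𝒢) (v : 𝒢.graph.Vertex)
    (hv : Finite (S.SV v).obj.V) : S.IsFinite :=
  ⟨fun w => (S.finite_nodeFibre_of_reachable (hconn.connected.preconnected (Sum.inl v) (Sum.inl w))).mp hv,
    fun e => (S.finite_nodeFibre_of_reachable
      (hconn.connected.preconnected (Sum.inl v) (Sum.inr (Sum.inl e)))).mp hv⟩

/-! ### Finite `π₁^temp`-sets are carried by the chart to finite étale coverings -/

section Chart

variable (c : TemperedPiChart 𝒢) (h𝒢 : ∀ S : CovObj 𝒢, S.IsFinite → S.IsTempered)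

/-- The data carrying the chart to finite étale coverings: connectedness of `𝒢` and a verticial
homomorphism at one vertex with its defining isomorphism ([SemiAnbd] Thm. 3.7 (i)).
[cite: MochizukiSemiAnbd2006, Thm 3.7(i) p.40] -/
structure ChartVertexDatum (c : TemperedPiChart 𝒢) : Type (u + 1) where
  /-- `𝒢` is connected -/
  hconn : 𝒢.graph.IsConnected
  /-- the vertex -/
  v : 𝒢.graph.Vertex
  /-- a verticial homomorphism `Π_v → π₁^temp(𝒢)` -/
  ψ : 𝒢.Gv v →ₜ* c.G
  /-- its defining isomorphism `c⁻¹ ⋙ (·)_v ≅ B^temp(ψ)` -/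
  e : c.equiv.inverse ⋙ ObjectProperty.ι _ ⋙ restrictV 𝒢 v ≅ BTemp.res ψ


/-- **`c⁻¹` of a finite `π₁^temp(𝒢)`-set is a finite covering**: its fibre at `v` is (along the verticial
isomorphism `e`) the underlying set itself, and finiteness propagates over the connected `𝒢`.
[cite: MochizukiSemiAnbd2006, Prop 3.6(iii) p.38] -/
theorem isFinite_chartInverse (d : ChartVertexDatum c) (Y : BTemp c.G) [hY : Finite Y.obj.V] :
    (c.equiv.inverse.obj Y).obj.IsFinite :=
  CovObj.isFinite_of_finite_SV d.hconn _ d.v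
    (Finite.of_equiv Y.obj.V
      { toFun := fun y => (d.e.inv.app Y).hom.hom y
        invFun := fun x => (d.e.hom.app Y).hom.hom x
        left_inv := fun y => by
          change ((d.e.inv ≫ d.e.hom).app Y).hom.hom y = y
          rw [Iso.inv_hom_id]
          rfl
        right_inv := fun x => by
          change ((d.e.hom ≫ d.e.inv).app Y).hom.hom x = x
          rw [Iso.hom_inv_id]
          rfl })

/-- The functor `B(π₁^temp(𝒢)) ⥤ BFinCat 𝒢`: a finite continuous `π₁^temp(𝒢)`-set, as a tempered object,
through `c⁻¹`, is a finite covering. [cite: MochizukiSemiAnbd2006, Prop 3.6(iii) p.38] -/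
def chartInverseFin (d : ChartVertexDatum c) : BCat c.G ⥤ BFinCat 𝒢 :=
  ObjectProperty.lift _ (toBTemp c.G ⋙ c.equiv.inverse ⋙ ObjectProperty.ι _)
    fun Y => isFinite_chartInverse c d ((toBTemp c.G).obj Y) (hY := inferInstanceAs (Finite Y.obj.V))

/-- The inclusion `BFinCat 𝒢 ⥤ BTempCat 𝒢` over the hypothesis that finite objects are tempered.
[cite: MochizukiSemiAnbd2006, Def 3.5(ii) p.37] -/
def finToTemp : BFinCat 𝒢 ⥤ BTempCat 𝒢 :=
  ObjectProperty.lift _ (ObjectProperty.ι _) fun S => h𝒢 _ S.property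

/-- `ofBObjFin ⋙ finToTemp = ofBObjTemp` (definitional). [cite: MochizukiSemiAnbd2006, Def 3.5(ii) p.37] -/
theorem ofBObjFin_comp_finToTemp : 𝒢.ofBObjFin ⋙ finToTemp h𝒢 = 𝒢.ofBObjTemp h𝒢 := rfl

/-- `chartInverseFin ⋙ finToTemp = toBTemp ⋙ c⁻¹` (definitional). [cite: MochizukiSemiAnbd2006, Prop 3.6(iii) p.38] -/
theorem chartInverseFin_comp_finToTemp (d : ChartVertexDatum c) :
    chartInverseFin c d ⋙ finToTemp h𝒢 = toBTemp c.G ⋙ c.equiv.inverse := rfl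

/-- **`B(π₁^temp(𝒢)) ⥤ B(𝒢.toAnab)`**: finite continuous `π₁^temp(𝒢)`-sets as finite étale coverings
(through `c⁻¹` and `equivBFin`). [cite: MochizukiSemiAnbd2006, Prop 3.6(iii) p.38] -/
def chartToBObj (d : ChartVertexDatum c) : BCat c.G ⥤ 𝒢.toAnab.BObj :=
  chartInverseFin c d ⋙ 𝒢.equivBFin.inverse

/-- **`chartToBObj ⋙ ofBObjTemp ⋙ c ≅ toBTemp`**: going to `B(𝒢.toAnab)` and back through the chart is
the identity on finite `π₁^temp(𝒢)`-sets (counits of `equivBFin` and of the chart).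
[cite: MochizukiSemiAnbd2006, Prop 3.6(iii) p.38] -/
def chartToBObjIso (d : ChartVertexDatum c) :
    chartToBObj c d ⋙ 𝒢.ofBObjTemp h𝒢 ⋙ c.equiv.functor ≅ toBTemp c.G :=
  -- `E₀ ⋙ eBF⁻¹ ⋙ (ofBObjFin ⋙ finToTemp) ⋙ c ≅ E₀ ⋙ finToTemp ⋙ c = toBTemp ⋙ c⁻¹ ⋙ c ≅ toBTemp`
  (show (chartInverseFin c d ⋙ 𝒢.equivBFin.inverse) ⋙
        (𝒢.ofBObjFin ⋙ finToTemp h𝒢) ⋙ c.equiv.functor ≅ _ from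
    Functor.isoWhiskerRight
        (Functor.associator _ _ _ ≪≫
          Functor.isoWhiskerLeft (chartInverseFin c d)
            ((Functor.associator _ _ _).symm ≪≫
              Functor.isoWhiskerRight 𝒢.equivBFin.counitIso (finToTemp h𝒢) ≪≫
              Functor.leftUnitor _))
        c.equiv.functor ≪≫
      (show (chartInverseFin c d ⋙ finToTemp h𝒢) ⋙ c.equiv.functor ≅ toBTemp c.G from
        Functor.associator _ _ _ ≪≫
          Functor.isoWhiskerLeft (toBTemp c.G) c.equiv.counitIso ≪≫ Functor.rightUnitor _))

/-- **The chart fibre functor on `chartToBObj` is the forgetful functor**: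
`chartToBObj ⋙ chartFibre ≅ forget ⋙ incl`. [cite: MochizukiSemiAnbd2006, Prop 3.6(iii) p.38] -/
def chartFibreToBObjIso (d : ChartVertexDatum c) :
    chartToBObj c d ⋙ chartFibre c h𝒢 ≅
      (ObjectProperty.ι (Action.IsContinuous (V := FintypeCat.{u}) (G := c.G)) ⋙
        Action.forget FintypeCat.{u} c.G) ⋙ FintypeCat.incl :=
  Functor.isoWhiskerRight (chartToBObjIso c h𝒢 d)
    ((temperedAction c.G).ι ⋙ Action.forget (Type u) c.G)

/-- On elements, `chartFibreToBObjIso` is the underlying map of `chartToBObjIso`.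
[cite: MochizukiSemiAnbd2006, Prop 3.6(iii) p.38] -/
theorem chartFibreToBObjIso_hom_app_apply (d : ChartVertexDatum c) (Y : BCat c.G)
    (y : (chartToBObj c d ⋙ chartFibre c h𝒢).obj Y) :
    (chartFibreToBObjIso c h𝒢 d).hom.app Y y =
      ((chartToBObjIso c h𝒢 d).hom.app Y).hom.hom y := rfl

/-- **Equivariance**: `chartFibreToBObjIso` carries the chart action of `g ∈ π₁^temp(𝒢)` on
`chartToBObj Y` to the given action of `g` on the finite `π₁^temp(𝒢)`-set `Y` (its components are
morphisms of `B^temp(π₁^temp(𝒢))`). [cite: MochizukiSemiAnbd2006, Prop 3.6(iii) p.38] -/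
theorem chartFibreToBObjIso_equivariant (d : ChartVertexDatum c) (g : c.G) (Y : BCat c.G)
    (y : (chartToBObj c d ⋙ chartFibre c h𝒢).obj Y) :
    (chartFibreToBObjIso c h𝒢 d).hom.app Y
        ((chartAction c h𝒢 g).hom.app ((chartToBObj c d).obj Y) y) =
      ConcreteCategory.hom (Y.obj.ρ g) ((chartFibreToBObjIso c h𝒢 d).hom.app Y y) :=
  ConcreteCategory.congr_hom (((chartToBObjIso c h𝒢 d).hom.app Y).hom.comm g) y

/-! ### Every finite étale covering is `chartToBObj` of its chart fibre -/

variable (hfin : ∀ X : 𝒢.toAnab.BObj, Finite ((chartFibre c h𝒢).obj X))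

/-- The finite `π₁^temp(𝒢)`-set `c(X)` of a finite étale covering `X` (as an object of `B(π₁^temp(𝒢))`).
[cite: MochizukiSemiAnbd2006, Prop 3.6(iii) p.38] -/
def chartFibreObj (X : 𝒢.toAnab.BObj) : BCat c.G :=
  @BTemp.toContAction c.G _ _ _ (c.equiv.functor.obj ((𝒢.ofBObjTemp h𝒢).obj X)) (hfin X)

/-- **Essential surjectivity of `chartToBObj` on the nose**: `chartToBObj (c X) ≅ X` (unit of the chart,
unit of `equivBFin`). [cite: MochizukiSemiAnbd2006, Prop 3.6(iii) p.38] -/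
def chartToBObjObjIso (d : ChartVertexDatum c) (X : 𝒢.toAnab.BObj) :
    (chartToBObj c d).obj (chartFibreObj c h𝒢 hfin X) ≅ X :=
  -- in `BFinCat`: `c⁻¹ (toBTemp (c X)) ≅ c⁻¹ (c X) ≅ ofBObjTemp X` (as coverings), i.e. `≅ ofBObjFin X`
  haveI : Finite (c.equiv.functor.obj ((𝒢.ofBObjTemp h𝒢).obj X)).obj.V := hfin X
  let i₀ : c.equiv.inverse.obj ((toBTemp c.G).obj (chartFibreObj c h𝒢 hfin X)) ≅
      (𝒢.ofBObjTemp h𝒢).obj X :=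
    c.equiv.inverse.mapIso
        (BTemp.toBTempToContActionIso (c.equiv.functor.obj ((𝒢.ofBObjTemp h𝒢).obj X))) ≪≫
      (c.equiv.unitIso.app ((𝒢.ofBObjTemp h𝒢).obj X)).symm
  let i₁ : (chartInverseFin c d).obj (chartFibreObj c h𝒢 hfin X) ≅ 𝒢.ofBObjFin.obj X :=
    (ObjectProperty.fullyFaithfulι (fun S : CovObj 𝒢 => S.IsFinite)).preimageIso
      ((ObjectProperty.ι (fun S : CovObj 𝒢 => S.IsTempered)).mapIso i₀)
  𝒢.equivBFin.inverse.mapIso i₁ ≪≫ (𝒢.equivBFin.unitIso.app X).symm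

end Chart

end ProfiniteSemiGraph

end Literature.AnabelianGeometry.SemiGraphs

end
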